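import Literature.MathematicalPhysics.QuantumFieldTheory.Balaban1983to89.B9Thm34GKernelFinal
import Literature.MathematicalPhysics.QuantumFieldTheory.Balaban1983to89.B9Thm34InvBlk

/-!
# `Balaban1983to89.B9Thm34GKernelFinalBlk` — [Balaban1985BackgroundPropagators] (3.76)–(3.77) pp. 405–406 FOR THE CONCRETE `P₁(A)` AND «THE
# INVERSE SATISFIES THEOREM 3.2» (p. 403), WITH THE `C = Q′G′²Q′*`-LETTERS ON A GENERAL FINITE BLOCK CARRIER `(P, blkP, rep)` — the append-only
# twin of r06's FILE 25 `B9Thm34GKernelFinal` §1 (`hasMajorant_pOne_coarse`) and §2 (`exists_cinv_pOne_concrete`) (R-Ker-4 FILE 1 of 4; cell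
# `pub-ymgap` N06 row 13, the Hölder members h1∕e4∕h2 of the G side; lit-balaban RULING #8 follow-up, r06 g68 INTENT 14:08Z): the P₁∕(3.77) clause
# that `B9Thm34POneUniformR1.exists_threshold_pOne_uniform` — hence `B9Thm34HolderGClauseUniformR1` ∕ `B9Thm34HolderInputGClauseUniformR1` and
# the N06 frames `B9SectBH1GStepAtLetters` ∕ `B9SectBE4H2GStepAtLetters` — call binds Theorem 3.2's `C⁻¹(U)` as a scalar operator on `g.Site → ℝ`
# with a printed-shape kernel bound; here the block carrier is any finite type `P` with block map `blkP : P → 𝔅` and an injective block-compatible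
# section `rep : P → S × ι`, and (3.48) is a [4] (2.51) block majorant over `blkP` (the currency of r06's R-Ker-1 `B9Thm34InvBlk.
# thm34_Cinv_uniform_blk` and R-Ker-2 `B9Thm34GUniformBlk.thm34_G_clause_uniform_blk`)

statement-level skeleton of published theorems with citation tags; proofs where landed; nothing here is a claim about the Yang–Mills mass gap

CITATION HEADER (lean-in-tree rule).  B9 = T. Bałaban, *Propagators for lattice gauge theories in a background field*, Commun. Math. Phys.
**99** (1985) 389–434 [Balaban1985BackgroundPropagators] (held `paper:balaban1985-cmp99-background-propagators`; journal page = PDF page + 388):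
(3.76)–(3.77) pp. 405–406 («This way we have proved that P₁(A) is an analytic function on the space (3.37) and satisfies the estimate (3.77)»,
p. 406); Thm 3.4 p. 400; p. 403 l. 8–12 («The inverse satisfies Theorem 3.2»); Thm 3.2 (3.48) p. 398; (3.49) p. 399; (3.68) p. 403; (3.19) p. 393,
(3.21)/(3.25) p. 394; (3.57) p. 401, (3.59)–(3.65) p. 402, (3.65)bis–(3.67) p. 403; Thm 3.1 (3.42) p. 397; (3.37) p. 396.  [4] =
[Balaban1984PropagatorsII] Lemma 2.1 p. 234, (2.51)–(2.55) p. 232, (2.66) p. 234; [B11] = [Balaban1985Variational] (135) p. 298.  Cell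
`lit-balaban`, seat r06 gen 68 (author lineage of FILES 15–25; R-Ker-4 FILE 1 of 4); rows B9.Eq3.76 × B9.Thm3.4 × B9.Thm3.2 × B9.Eq3.66 × B9.Eq3.68.

WHAT IS PROVED (0 `def`, 0 sorry, 0 new named facts; standard axioms).
* §1 **`hasMajorant_pOne_coarse_blk`** — FILE 25 §1 `hasMajorant_pOne_coarse` VERBATIM except: section `(blkP : P → g.Site) (rep : P → S × ι)
  (hrep : ∀ p, blk (rep p).1 = blkP p) (hinj : Function.Injective rep)`; letters `Qc Qc' Fc : (S × ι → ℝ) →ₗ[ℝ] (P → ℝ)`, `Qcs Qcs' Fcs : (P → ℝ)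
  →ₗ[ℝ] (S × ι → ℝ)`, `Linv Linv' Ccp : Module.End ℝ (P → ℝ)`; (3.48) for `C⁻¹(U)`, `C⁻¹(U′U)` and (3.66) for `C′(A)` as block majorants over `blkP`.
  PROOF verbatim: FILE 17's section dictionary at `blkZ := blkP`, the word identity, then FILE 25 §1 `hasMajorant_pOne_site` BY NAME (site level,
  carrier-free).
* §2 **`exists_cinv_pOne_concrete_blk`** — FILE 25 §2 `exists_cinv_pOne_concrete` VERBATIM except the same binder group; `C⁻¹(U′U) : Module.End ℝ
  (P → ℝ)`.  PROOF verbatim with `B9Thm34InvBlk.inverse_satisfies_thm32_vPrime_blk` ∕ `hasMajorant_cPrimeHom_vPrime_blk` and §1.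

HONEST SCOPE / NOT CLAIMED.  As FILE 25 §1/§2 (bookkeeping over landed modules; explicit rate cascade and thresholds are the callers' — FILE 2
`B9Thm34POneUniformBlk`); §3/§4 of FILE 25 (per-lattice thresholds, the kernel-form G-entries) are NOT twinned here (not on the R-Ker-4 path);
nothing of [B9] asserted beyond the landed modules; N06 NOT discharged; nothing continuum ∕ OS ∕ mass-gap ∕ Clay.  FILE 25 is the special case
`P := g.Site`, `blkP := id`; kept, not edited.

RELATED IN THE TREE, NOT DUPLICATED (2026-08-28: `rg 'pOne_coarse_blk|cinv_pOne_concrete_blk|GKernelFinalBlk'` over `Literature/` = ∅): FILE 25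
`B9Thm34GKernelFinal` (§1 `hasMajorant_pOne_site` BY NAME), r06 R-Ker-1 `B9Thm34InvBlk`, FILE 18/19 twins `B9Thm34GCoarseBlk` ∕ `B9Thm34GConcreteCBlk`
(same dictionary), `B9Ineq366Vprime`/`B9Ineq363Vprime`/`B9Eq360Vprime` USED BY NAME; no existing module modified.
-/

noncomputable section

namespace Literature.MathematicalPhysics.QuantumFieldTheory.Balaban1983to89.B9Thm34GKernelFinalBlk

open NormedSpace Complex
open Literature.MathematicalPhysics.QuantumFieldTheory.Balaban1983to89
open Literature.MathematicalPhysics.QuantumFieldTheory.Balaban1983to89.B6RandomWalk (HasMajorant hasMajorant_mono Triangle254 Ineq261)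
open Literature.MathematicalPhysics.QuantumFieldTheory.Balaban1983to89.B6RandomWalkHom (HasMajorantHom hasMajorantHom_mono hasMajorantHom_iff)
open Literature.MathematicalPhysics.QuantumFieldTheory.Balaban1983to89.B6RandomWalkKernel (HasKernelBound hasKernelBound_mono)
open Literature.MathematicalPhysics.QuantumFieldTheory.Balaban1983to89.B9Thm34Ext (toB6)
open Literature.MathematicalPhysics.QuantumFieldTheory.Balaban1983to89.B9Ineq347 (ScaleTransfer)
open Literature.MathematicalPhysics.QuantumFieldTheory.Balaban1983to89.B9Ineq366CPrime (hasMajorant_rate_mono cPrimeHom kappa366 kappa366_nonneg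
  kappa366_pos)
open Literature.MathematicalPhysics.QuantumFieldTheory.Balaban1983to89.B9Eq386Neumann (pTwo deltaA)
open Literature.MathematicalPhysics.QuantumFieldTheory.Balaban1983to89.B9Ineq377POne (kappa377 kappa377_nonneg)
open Literature.MathematicalPhysics.QuantumFieldTheory.Balaban1983to89.B9Ineq385VG (kappa383 kappa383_nonneg kappa385 kappa385_nonneg)
open Literature.MathematicalPhysics.QuantumFieldTheory.Balaban1983to89.B9Eq39Adjoint
open Literature.MathematicalPhysics.QuantumFieldTheory.Balaban1983to89.B9Eq369Small (Through)
open Literature.MathematicalPhysics.QuantumFieldTheory.Balaban1983to89.B9Eq372Locality (stBonds)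
open Literature.MathematicalPhysics.QuantumFieldTheory.Balaban1983to89.B9Eq352DivForm (tauF tauB)
open Literature.MathematicalPhysics.QuantumFieldTheory.Balaban1983to89.B9Eq352DivFormLetters
open Literature.MathematicalPhysics.QuantumFieldTheory.Balaban1983to89.B9Eq352GradLetters (diffLetter)
open Literature.MathematicalPhysics.QuantumFieldTheory.Balaban1983to89.B9Eq371GradLetters (bT bU)
open Literature.MathematicalPhysics.QuantumFieldTheory.Balaban1983to89.B9Eq372RemLetters (lapDDLetter)
open Literature.MathematicalPhysics.QuantumFieldTheory.Balaban1983to89.B9Eq382V3Letters (dPrimeLetter)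
open Literature.MathematicalPhysics.QuantumFieldTheory.Balaban1983to89.B9Eq376POneLetters (conjHom gradLin divLin)
open Literature.MathematicalPhysics.QuantumFieldTheory.Balaban1983to89.B9Ineq385V3Concrete (cV385 cV385_nonneg)
open Literature.MathematicalPhysics.QuantumFieldTheory.Balaban1983to89.B9Ineq377POneConcrete (ineq377_concreteE)
open Literature.MathematicalPhysics.QuantumFieldTheory.Balaban1983to89.B9Ineq349Hom (ineq349_hom)
open Literature.MathematicalPhysics.QuantumFieldTheory.Balaban1983to89.B9Ineq368PPrime (kappa349 kappa368)
open Literature.MathematicalPhysics.QuantumFieldTheory.Balaban1983to89.B9Ineq368PPrimeDs (kappa368Ds kappa368Ds_nonneg kappa368_nonneg kappa349_nonneg)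
open Literature.MathematicalPhysics.QuantumFieldTheory.Balaban1983to89.B9Eq360Vprime (gPrimeExtEnd eq365_end_left eq365_end opNorm_lt_one_of_363_261)
open Literature.MathematicalPhysics.QuantumFieldTheory.Balaban1983to89.B9Eq360VprimeLetters (vPrimeConc cBConc cCConc)
open Literature.MathematicalPhysics.QuantumFieldTheory.Balaban1983to89.B9Ineq363Vprime (cVConc cVConc_nonneg theta363 thetaL363 theta363_nonneg
  thetaL363_nonneg ineq363_op_vPrime)
open Literature.MathematicalPhysics.QuantumFieldTheory.Balaban1983to89.B9Ineq368Vprime (ineq368_op_conc ineq368_op_D_conc ineq368_op_Ds_conc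
  ineq368_op_DDs_conc)
open Literature.MathematicalPhysics.QuantumFieldTheory.Balaban1983to89.B9Eq376DerivDict (hasMajorantHom_gradLin_comp hasMajorantHom_gradLin
  hasMajorantHom_comp_divLin hasMajorantHom_divLin hasMajorant_gradLin_comp_comp_divLin)
open Literature.MathematicalPhysics.QuantumFieldTheory.Balaban1983to89.B6RandomWalkSection
open Literature.MathematicalPhysics.QuantumFieldTheory.Balaban1983to89.B9Ineq366Vprime (eq365b_hom)
open Literature.MathematicalPhysics.QuantumFieldTheory.Balaban1983to89.B9Thm34InvBlk (hasMajorant_cPrimeHom_vPrime_blk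
  inverse_satisfies_thm32_vPrime_blk)
open Literature.MathematicalPhysics.QuantumFieldTheory.Balaban1983to89.B9Thm34GFinal (ineq261_rescale scaleTransfer_rescale c1_pos_of_ineq261
  exists_threshold_of_continuousAt)
open Literature.MathematicalPhysics.QuantumFieldTheory.Balaban1983to89.B9Thm34GKernelFinal (hasMajorant_pOne_site)

/-! ## §1  (3.77) for the concrete `P₁(A)`: coarse letters on a general block carrier, through an injective section -/

section POne

variable {𝔸 : Type*} [NormedRing 𝔸] [NormedAlgebra ℂ 𝔸] [CompleteSpace 𝔸] {ι : Type} [Fintype ι]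
variable (b : Module.Basis ι ℝ 𝔸) {S : Type} {κ : Type} [Fintype κ] [LinearOrder κ]
variable (T : κ → Equiv.Perm S) (U : κ → S → 𝔸ˣ)
variable {g : B9.Geometry} [Fintype g.Site] {Rr : ℝ} {H : Prop}

omit [LinearOrder κ] in
set_option maxHeartbeats 800000 in
/-- **(3.77) FOR THE CONCRETE `P₁(A)`, COARSE-LATTICE LETTERS ON A GENERAL BLOCK CARRIER `(P, blkP, rep)`** — FILE 25 §1
`B9Thm34GKernelFinal.hasMajorant_pOne_site` with `Q′, F′₂ : sites → P`, `Q′*, F′₂* : P → sites` block-local two-space letters ((3.19), (3.57),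
(3.59)) between `blk ∘ Prod.fst` and `blkP`, `C⁻¹(U)`, `C⁻¹(U′U)` given by Theorem 3.2's (3.48) as [4] (2.51) BLOCK MAJORANTS over `blkP`, `C′(A)` by
its (3.66) block majorant over `blkP` and (3.67) on `P`, read on the sites through an injective block-compatible section `rep : P → S × ι` (FILE 17
`B6RandomWalkSection`); `P(U) = G′ ∘ Q′* ∘ C⁻¹ ∘ Q′ ∘ G′` the genuine two-space word and `P′(A)` its `pPrime` word through `rep`.  FILE 25's
`hasMajorant_pOne_coarse` is the case `P = 𝔅`, `blkP = id`.
[cite: Balaban1985BackgroundPropagators, (3.76)–(3.77) pp.405–406 + (3.49) p.399 + (3.68) p.403 + (3.25) p.394 + (3.19) p.393 + (3.57) p.401 + (3.59) p.402 + (3.65)–(3.67) pp.402–403 + Thm 3.1 (3.42) p.397 + Thm 3.2 (3.48) p.398 + (3.37) p.396; Balaban1984PropagatorsII, Lemma 2.1 p.234 + (2.51)–(2.55) p.232; Balaban1985Variational, (135) p.298] -/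
theorem hasMajorant_pOne_coarse_blk {P : Type} [Fintype S] [DecidableEq S] [DecidableEq ι] [DecidableEq g.Site] (blk : S → g.Site) (d : ℕ)
    (δ₀ δ δP δG α β ρ₁ α'' Λ Λρ₁ κQ BG B₁ Bc' κC cF Cq a₀ κP κP' κ₁ α₁ d₀ M₂ : ℝ)
    (kQ kF : g.Site → S → 𝔸 →L[ℝ] 𝔸) (sQ sF : S → 𝔸 →L[ℝ] 𝔸) (cfun w : g.Site → ℝ)
    (hκQ : 0 ≤ κQ) (hBG : 0 ≤ BG) (hB₁ : 0 ≤ B₁) (hBc' : 0 ≤ Bc') (hκC : 0 ≤ κC) (hcF : 0 ≤ cF) (hCq : 0 ≤ Cq) (ha₀ : 0 ≤ a₀) (hκP' : 0 ≤ κP')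
    (hα₁ : 0 ≤ α₁) (hΛ : 1 ≤ Λ) (hα : 0 ≤ α) (hβ : 0 ≤ β) (hδ₀ : 0 ≤ δ₀) (hδ : 0 ≤ δ) (hM₂ : 0 ≤ M₂)
    (hrP : δ + 2 * ((α + β) * δ₀) ≤ δP) (hrG : δP + (2 * α + β) * δ₀ ≤ δG)
    (hr1 : ρ₁ + (α + β) * δ₀ ≤ δG) (hα''1 : α'' ≤ 1) (hα''0 : 0 ≤ α'') (hρ₁ : 0 ≤ ρ₁) (hα''ρ : 0 ≤ (1 - α'') * ρ₁)
    (hα''ρ2 : 0 ≤ (1 - 2 * α'') * ρ₁) (hα''ρ3 : 0 ≤ (1 - 3 * α'') * ρ₁) (hΛρ₁ : 0 ≤ Λρ₁)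
    (hr368 : δP + 2 * ((2 * α + β) * δ₀) ≤ B9Ineq368Vprime.rateC α'' ρ₁)
    (hκP : κP = kappa349 κQ ((1 + Fintype.card κ) * BG) B₁ Λ (B6.c1 d δ₀ β))
    (hκ₁ : κ₁ = kappa377 (4 * (1 + Fintype.card κ) * (M₂ * ∑ i, ‖b i‖) * Real.exp (δP * d₀)) κP κP' Λ (B6.c1 d δ₀ β) α₁)
    (hdnn : ∀ a a' : g.Site, 0 ≤ g.dist a a') (htri : Triangle254 (toB6 g Rr H)) (hrefl : ∀ y : g.Site, g.dist y y = 0)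
    (hsym : ∀ y y' : g.Site, g.dist y y' = g.dist y' y) (hlen : ∀ y : g.Site, 0 < g.len y)
    (h261 : Ineq261 d (toB6 g Rr H) δ₀ β) (h261'' : Ineq261 d (toB6 g Rr H) ρ₁ α'')
    (hT1 : ScaleTransfer g δ₀ α Λ (fun a => g.len a)) (hT2 : ScaleTransfer g δ₀ α Λ (fun a => g.len a ^ 2))
    (hT1i : ScaleTransfer g δ₀ α Λ (fun a => (g.len a)⁻¹)) (hT2i : ScaleTransfer g δ₀ α Λ (fun a => (g.len a ^ 2)⁻¹))
    (hT4 : ScaleTransfer g δ₀ α Λ (fun a => (g.len a ^ 4)⁻¹))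
    (hTρ₁ : ScaleTransfer g ρ₁ α'' Λρ₁ (fun a => g.len a))
    (hrepr : ∀ (v : 𝔸) (i : ι), |b.repr v i| ≤ M₂ * ‖v‖) (hη : 0 < g.eta) (A : κ → S → 𝔸)
    (hsmall : ∀ y : g.Site, g.eta * (α₁ * (g.len y)⁻¹) ≤ 1 / 4)
    (hU1 : ∀ m z, ‖((U m z : 𝔸ˣ) : 𝔸)‖ ≤ 1 ∧ ‖(((U m z)⁻¹ : 𝔸ˣ) : 𝔸)‖ ≤ 1)
    (h337B : ∀ ν k x, ‖((g.eta : ℂ)⁻¹) • covDstar T U ν (A k) x‖ ≤ α₁ * (g.len (blk x) ^ 2)⁻¹)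
    (h337F : ∀ μ ν x, ‖((g.eta : ℂ)⁻¹) • covD T U μ (A ν) x‖ ≤ α₁ * (g.len (blk x) ^ 2)⁻¹)
    (h337Bτ : ∀ μ x, ‖((g.eta : ℂ)⁻¹) • covDstar T U μ (tauB T U μ (A μ)) x‖ ≤ α₁ * (g.len (blk x) ^ 2)⁻¹)
    (hA : ∀ k x, ‖A k x‖ ≤ α₁ * (g.len (blk x))⁻¹) (hAτB : ∀ ν k x, ‖tauB T U ν (A k) x‖ ≤ α₁ * (g.len (blk x))⁻¹)
    (hd₀B : ∀ μ x, g.dist (blk x) (blk ((T μ).symm x)) ≤ d₀) (hd₀F : ∀ μ x, g.dist (blk x) (blk (T μ x)) ≤ d₀)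
    (hd₀0 : ∀ y : g.Site, g.dist y y ≤ d₀)
    -- Theorem 3.1 (3.42)₁,₂,₃ for `G′(U)` at the rate `δ_G`
    {Gp : Module.End ℝ (S × ι → ℝ)}
    (h342_1 : HasMajorant (g := toB6 g Rr H) (fun p : S × ι => blk p.1) Gp
      (fun a a' => BG * g.len a ^ 2 * Real.exp (-(δG * g.dist a a'))))
    (h342_2 : ∀ k : κ ⊕ κ, HasMajorant (g := toB6 g Rr H) (fun p : S × ι => blk p.1)
      (conj b (diffLetter T U ((g.eta : ℂ)⁻¹) k) * Gp) (fun a a' => BG * g.len a * Real.exp (-(δG * g.dist a a'))))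
    (h342_3 : ∀ k : κ ⊕ κ, HasMajorant (g := toB6 g Rr H) (fun p : S × ι => blk p.1)
      (Gp * conj b (diffLetter T U ((g.eta : ℂ)⁻¹) k)) (fun a a' => BG * g.len a * Real.exp (-(δG * g.dist a a'))))
    -- the coarse-lattice letters on a general finite block carrier `P` (block map `blkP`), read through an injective block-compatible
    -- section `rep : P → S × ι` (FILE 17; FILE 18 twin `B9Thm34GCoarseBlk`)
    (blkP : P → g.Site) (rep : P → S × ι) (hrep : ∀ p : P, blk (rep p).1 = blkP p) (hinj : Function.Injective rep)
    {Qc Qc' Fc : (S × ι → ℝ) →ₗ[ℝ] (P → ℝ)} {Qcs Qcs' Fcs : (P → ℝ) →ₗ[ℝ] (S × ι → ℝ)}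
    {Linv Linv' Ccp : Module.End ℝ (P → ℝ)}
    (h357 : Qc' = Qc + Fc) (h357s : Qcs' = Qcs + Fcs) (h367 : Linv' - Linv = -(Linv' * Ccp * Linv))
    (hQc : HasMajorantHom (g := toB6 g Rr H) (fun p : S × ι => blk p.1) blkP Qc
      (fun a a' : g.Site => if a = a' then κQ else 0))
    (hQcs : HasMajorantHom (g := toB6 g Rr H) blkP (fun p : S × ι => blk p.1) Qcs
      (fun a a' : g.Site => if a = a' then κQ else 0))
    (hFc : HasMajorantHom (g := toB6 g Rr H) (fun p : S × ι => blk p.1) blkP Fc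
      (fun a a' : g.Site => if a = a' then cF * α₁ else 0))
    (hFcs : HasMajorantHom (g := toB6 g Rr H) blkP (fun p : S × ι => blk p.1) Fcs
      (fun a a' : g.Site => if a = a' then cF * α₁ else 0))
    (h348 : HasMajorant (g := toB6 g Rr H) blkP Linv
      (fun a a' => B₁ * g.len a ^ (-(4 : ℝ)) * Real.exp (-(δG * g.dist a a'))))
    (h348' : HasMajorant (g := toB6 g Rr H) blkP Linv'
      (fun a a' => Bc' * g.len a ^ (-(4 : ℝ)) * Real.exp (-(δG * g.dist a a'))))
    (h366 : HasMajorant (g := toB6 g Rr H) blkP Ccp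
      (fun a a' => κC * α₁ * g.len a ^ 4 * Real.exp (-(δG * g.dist a a'))))
    (hw : ∀ y, 0 ≤ w y) (hcard : ∀ y, ((B9Eq360Vprime.block blk y).card : ℝ) * w y ≤ 1)
    (hkQ : ∀ y x, blk x = y → ‖kQ y x‖ ≤ w y) (hkF : ∀ y x, blk x = y → ‖kF y x‖ ≤ Cq * α₁ * w y)
    (hsQ : ∀ x, ‖sQ x‖ ≤ 1) (hsF : ∀ x, ‖sF x‖ ≤ Cq * α₁) (hcfun : ∀ y, |cfun y| ≤ a₀ * (g.len y ^ 2)⁻¹)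
    (hθ : theta363 (Fintype.card κ) 1 α₁ a₀ Cq M₂ (∑ i, ‖b i‖) (Real.exp (δG * d₀)) BG Λ (B6.c1 d δ₀ β) *
      B6.c1 d ρ₁ α'' < 1)
    (hθL : thetaL363 (Fintype.card κ) 1 α₁ a₀ Cq M₂ (∑ i, ‖b i‖) (Real.exp (δG * d₀)) BG Λ (B6.c1 d δ₀ β) *
      B6.c1 d ρ₁ α'' < 1)
    -- the constant `κ_{P′}` of the (3.77)-step dominates the four explicit (3.68)-constants of `B9Ineq368Vprime`
    (hK1 : kappa368 κQ cF
        (kappa385 1 (cVConc (Fintype.card κ) 1 α₁ a₀ Cq M₂ (∑ i, ‖b i‖) (Real.exp (δG * d₀))) 0 0 Λ (B6.c1 d δ₀ β))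
        κC BG BG (BG * B6.c1 d ρ₁ α'' *
          (1 - theta363 (Fintype.card κ) 1 α₁ a₀ Cq M₂ (∑ i, ‖b i‖) (Real.exp (δG * d₀)) BG Λ (B6.c1 d δ₀ β) * B6.c1 d ρ₁ α'')⁻¹)
        B₁ Bc' Λ (B6.c1 d δ₀ β) α₁ ≤ κP')
    (hK3 : Fintype.card κ * kappa368Ds κQ cF
        (kappa385 BG (cVConc (Fintype.card κ) 1 α₁ a₀ Cq M₂ (∑ i, ‖b i‖) (Real.exp (δG * d₀))) 0 0 Λ (B6.c1 d δ₀ β))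
        κC BG BG BG (B6.c1 d ρ₁ α'' *
          (1 - theta363 (Fintype.card κ) 1 α₁ a₀ Cq M₂ (∑ i, ‖b i‖) (Real.exp (δG * d₀)) BG Λ (B6.c1 d δ₀ β) * B6.c1 d ρ₁ α'')⁻¹)
        (BG * Λρ₁ ^ 2 * B6.c1 d ρ₁ α'' *
          (1 - thetaL363 (Fintype.card κ) 1 α₁ a₀ Cq M₂ (∑ i, ‖b i‖) (Real.exp (δG * d₀)) BG Λ (B6.c1 d δ₀ β) * B6.c1 d ρ₁ α'')⁻¹)
        B₁ Bc' (cBConc (Fintype.card κ) M₂ (∑ i, ‖b i‖) (Real.exp (B9Ineq368Vprime.rateC α'' ρ₁ * d₀)))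
        (cCConc (Fintype.card κ) 1 α₁ a₀ Cq M₂ (∑ i, ‖b i‖) (Real.exp (B9Ineq368Vprime.rateC α'' ρ₁ * d₀))) Λ (B6.c1 d δ₀ β) α₁
        ≤ κP') :
    HasMajorant (g := toB6 g Rr H) (fun q : (κ × S) × ι => blk q.1.2)
      (((conjHom b (gradLin T ((g.eta : ℂ)⁻¹) (prodCfg U g.eta A)) - conjHom b (gradLin T ((g.eta : ℂ)⁻¹) U)) ∘ₗ (Gp ∘ₗ Qcs ∘ₗ Linv ∘ₗ Qc ∘ₗ Gp) ∘ₗ conjHom b (divLin T ((g.eta : ℂ)⁻¹) U)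
            + conjHom b (gradLin T ((g.eta : ℂ)⁻¹) U) ∘ₗ (Gp ∘ₗ Qcs ∘ₗ Linv ∘ₗ Qc ∘ₗ Gp) ∘ₗ (conjHom b (divLin T ((g.eta : ℂ)⁻¹) (prodCfg U g.eta A)) - conjHom b (divLin T ((g.eta : ℂ)⁻¹) U))
            + (conjHom b (gradLin T ((g.eta : ℂ)⁻¹) (prodCfg U g.eta A)) - conjHom b (gradLin T ((g.eta : ℂ)⁻¹) U)) ∘ₗ (Gp ∘ₗ Qcs ∘ₗ Linv ∘ₗ Qc ∘ₗ Gp) ∘ₗ (conjHom b (divLin T ((g.eta : ℂ)⁻¹) (prodCfg U g.eta A)) - conjHom b (divLin T ((g.eta : ℂ)⁻¹) U))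
            + conjHom b (gradLin T ((g.eta : ℂ)⁻¹) (prodCfg U g.eta A)) ∘ₗ (B9Eq360Vprime.pPrime Gp (gPrimeExtEnd Gp (conj b (vPrimeConc T U g.eta A blk kQ kF sQ sF cfun) * Gp)) (Qcs ∘ₗ secRes rep) (Qcs' ∘ₗ secRes rep) (secConj rep Linv) (secConj rep Linv') (secExt rep ∘ₗ Qc) (secExt rep ∘ₗ Qc')) ∘ₗ conjHom b (divLin T ((g.eta : ℂ)⁻¹) (prodCfg U g.eta A))))
      (fun a a' => κ₁ * α₁ * (g.len a ^ 2)⁻¹ * Real.exp (-(δ * g.dist a a'))) := by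
  -- the section's block-compatibility in the shape FILE 17 reads (injectivity is the hypothesis `hinj`)
  have hrep' : ∀ p : P, (fun p : S × ι => blk p.1) (rep p) = blkP p := hrep
  have hKQ : ∀ a a' : g.Site, 0 ≤ (if a = a' then κQ else 0) := fun a a' => by
    split_ifs
    · exact hκQ
    · exact le_rfl
  have hKF : ∀ a a' : g.Site, 0 ≤ (if a = a' then cF * α₁ else 0) := fun a a' => by
    split_ifs
    · exact mul_nonneg hcF hα₁
    · exact le_rfl
  -- the coarse-lattice letters read on the sites (FILE 17): the hypotheses `hQp … hCp`, `h357p`, `h357ps`, `hCC` of FILES 15/16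
  have hQp : HasMajorant (g := toB6 g Rr H) (fun p : S × ι => blk p.1) (secExt rep ∘ₗ Qc)
      (fun a a' : g.Site => if a = a' then κQ else 0) :=
    hasMajorant_secExt_comp (g := toB6 g Rr H) (blkX := fun p : S × ι => blk p.1) (blkZ := blkP) hrep' hKQ hQc
  have hQps : HasMajorant (g := toB6 g Rr H) (fun p : S × ι => blk p.1) (Qcs ∘ₗ secRes rep)
      (fun a a' : g.Site => if a = a' then κQ else 0) :=
    hasMajorant_comp_secRes (g := toB6 g Rr H) (blkX := fun p : S × ι => blk p.1) (blkZ := blkP) hrep' hQcs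
  have hFp : HasMajorant (g := toB6 g Rr H) (fun p : S × ι => blk p.1) (secExt rep ∘ₗ Fc)
      (fun a a' : g.Site => if a = a' then cF * α₁ else 0) :=
    hasMajorant_secExt_comp (g := toB6 g Rr H) (blkX := fun p : S × ι => blk p.1) (blkZ := blkP) hrep' hKF hFc
  have hFps : HasMajorant (g := toB6 g Rr H) (fun p : S × ι => blk p.1) (Fcs ∘ₗ secRes rep)
      (fun a a' : g.Site => if a = a' then cF * α₁ else 0) :=
    hasMajorant_comp_secRes (g := toB6 g Rr H) (blkX := fun p : S × ι => blk p.1) (blkZ := blkP) hrep' hFcs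
  have h357p : secExt rep ∘ₗ Qc' = secExt rep ∘ₗ Qc + secExt rep ∘ₗ Fc := by rw [h357, secExt_comp_add]
  have h357ps : Qcs' ∘ₗ secRes rep = Qcs ∘ₗ secRes rep + Fcs ∘ₗ secRes rep := by rw [h357s, add_comp_secRes]
  have hCC : secConj rep Linv' - secConj rep Linv = -(secConj rep Linv' * secConj rep Ccp * secConj rep Linv) :=
    secConj_resolvent hinj h367
  have hw4 : ∀ y : g.Site, g.len y ^ (-(4 : ℝ)) = (g.len y ^ 4)⁻¹ := fun y => by
    rw [Real.rpow_neg (hlen y).le, show (4 : ℝ) = ((4 : ℕ) : ℝ) by norm_num, Real.rpow_natCast]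
  have hCinv : HasMajorant (g := toB6 g Rr H) (fun p : S × ι => blk p.1) (secConj rep Linv)
      (fun a a' => B₁ * (g.len a ^ 4)⁻¹ * Real.exp (-(δG * g.dist a a'))) := by
    have h := hasMajorant_secConj (g := toB6 g Rr H) (blkX := fun p : S × ι => blk p.1) (blkZ := blkP) hrep'
      (fun a a' => mul_nonneg (mul_nonneg hB₁ (Real.rpow_nonneg (hlen a).le _)) (Real.exp_nonneg _)) h348
    exact hasMajorant_mono (g := toB6 g Rr H) _ h fun a a' => by rw [hw4 a]
  have hCinv' : HasMajorant (g := toB6 g Rr H) (fun p : S × ι => blk p.1) (secConj rep Linv')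
      (fun a a' => Bc' * (g.len a ^ 4)⁻¹ * Real.exp (-(δG * g.dist a a'))) := by
    have h := hasMajorant_secConj (g := toB6 g Rr H) (blkX := fun p : S × ι => blk p.1) (blkZ := blkP) hrep'
      (fun a a' => mul_nonneg (mul_nonneg hBc' (Real.rpow_nonneg (hlen a).le _)) (Real.exp_nonneg _)) h348'
    exact hasMajorant_mono (g := toB6 g Rr H) _ h fun a a' => by rw [hw4 a]
  have hCp : HasMajorant (g := toB6 g Rr H) (fun p : S × ι => blk p.1) (secConj rep Ccp)
      (fun a a' => κC * α₁ * g.len a ^ 4 * Real.exp (-(δG * g.dist a a'))) :=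
    hasMajorant_secConj (g := toB6 g Rr H) (blkX := fun p : S × ι => blk p.1) (blkZ := blkP) hrep'
      (fun a a' => mul_nonneg (mul_nonneg (mul_nonneg hκC hα₁) (pow_nonneg (hlen a).le 4)) (Real.exp_nonneg _)) h366
  -- the word of `P(U)` through the section IS `G′Q′*C⁻¹Q′G′` (FILE 17 `word_secConj`, here pointwise for this bracketing)
  have hPw : (Gp ∘ₗ (Qcs ∘ₗ secRes rep) ∘ₗ secConj rep Linv ∘ₗ (secExt rep ∘ₗ Qc) ∘ₗ Gp) = (Gp ∘ₗ Qcs ∘ₗ Linv ∘ₗ Qc ∘ₗ Gp) :=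
    LinearMap.ext fun F => by simp only [LinearMap.comp_apply, secConj_def, secRes_secExt_apply hinj]
  have h := hasMajorant_pOne_site (Rr := Rr) (H := H) b T U blk d δ₀ δ δP δG α β ρ₁ α'' Λ Λρ₁ κQ BG B₁ Bc' κC cF Cq a₀ κP κP' κ₁ α₁ d₀ M₂
    kQ kF sQ sF cfun w hκQ hBG hB₁ hBc' hκC hcF hCq ha₀ hκP' hα₁ hΛ hα hβ hδ₀ hδ hM₂ hrP hrG hr1 hα''1 hα''0 hρ₁ hα''ρ hα''ρ2 hα''ρ3 hΛρ₁
    hr368 hκP hκ₁ hdnn htri hrefl hsym hlen h261 h261'' hT1 hT2 hT1i hT2i hT4 hTρ₁ hrepr hη A hsmall hU1 h337B h337F h337Bτ hA hAτB hd₀B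
    hd₀F hd₀0 h342_1 h342_2 h342_3 h357p h357ps hCC hQp hQps hFp hFps hCinv hCinv' hCp hw hcard hkQ hkF hsQ hsF hcfun hθ hθL hK1 hK3
  rw [hPw] at h
  exact h

end POne

/-! ## §2  «The inverse satisfies Theorem 3.2» and (3.77) for the concrete `P₁(A)` built with `C⁻¹(U′U)`, on the block carrier `P` -/

section CInv

variable {𝔸 : Type*} [NormedRing 𝔸] [NormedAlgebra ℂ 𝔸] [CompleteSpace 𝔸] {ι : Type} [Fintype ι]
variable (b : Module.Basis ι ℝ 𝔸) {S : Type} {κ : Type} [Fintype κ] [LinearOrder κ]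
variable (T : κ → Equiv.Perm S) (U : κ → S → 𝔸ˣ)
variable {g : B9.Geometry} [Fintype g.Site] {Rr : ℝ} {H : Prop}

omit [LinearOrder κ] in
set_option maxHeartbeats 800000 in
/-- **«THE INVERSE SATISFIES THEOREM 3.2» + (3.77) FOR THE CONCRETE `P₁(A)`, GENERAL BLOCK CARRIER `(P, blkP, rep)`** — FILE 25 §2
`B9Thm34GKernelFinal.exists_cinv_pOne_concrete` VERBATIM except that the `C`-letters live on `P`: for the concrete `V′(A)` of (3.60) and
`G′(U′U) = gPrimeExtEnd G′ (V′G′)` ((3.64)), Theorem 3.2 for `U` ((3.21) `hLinv` two-sided on `P → ℝ`, (3.48) `h348` as a [4] (2.51) block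
majorant over `blkP`), Theorem 3.1's (3.42)₁₋₃ for `G′(U)` at the rate `δ1`, the devices of r06's R-Ker-1 `B9Thm34InvBlk.
inverse_satisfies_thm32_vPrime_blk` / `hasMajorant_cPrimeHom_vPrime_blk` (rates `(ρc, αc)`, `α_v`, `α₃`, `c₄`, the smallness
`θ₃₆₃(δ1)c₁(ρc,αc) < 1`, the explicit threshold `ha₁`, `κ_C`, `B_c′` named by equations), the (3.19)/(3.57)/(3.59) two-space letters between the
sites and `P` and an injective block-compatible section `rep : P → S × ι`: THERE EXISTS `C⁻¹(U′U)` (`Tinv : Module.End ℝ (P → ℝ)`), two-sided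
inverse of `Q′(U′U)G′²(U′U)Q′*(U′U)` on `P`, AND the concrete `P₁(A)` of (3.76) built with it obeys (3.77): `P₁(A) ≺ κ₁·α₁·(Lʲη)⁻²·e^{−δd}`.  PROOF
verbatim: `inverse_satisfies_thm32_vPrime_blk`, `hasMajorant_cPrimeHom_vPrime_blk`, (3.63) ⇒ `‖V′G′‖ < 1` ⇒ (3.65) ⇒ `L′ = L + C′(A)` ⇒ (3.67), the
two rate weakenings by `hasMajorant_rate_mono`, then §1 `hasMajorant_pOne_coarse_blk`.  FILE 25's theorem is the case `P = 𝔅`, `blkP = id`.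
[cite: Balaban1985BackgroundPropagators, Thm 3.4 p.400 + Thm 3.2 (3.48) p.398 + p.403 + (3.57)–(3.67) pp.401–403 + (3.76)–(3.77) pp.405–406 + (3.49) p.399 + (3.68) p.403 + (3.19)/(3.21)/(3.25) pp.393–394 + Thm 3.1 (3.42) p.397 + (3.37) p.396; Balaban1984PropagatorsII, Lemma 2.1 p.234 + (2.51)–(2.55) p.232 + (2.66) p.234; Balaban1985Variational, (135) p.298] -/
theorem exists_cinv_pOne_concrete_blk {P : Type} [Fintype P] [DecidableEq P] [Fintype S] [DecidableEq S] [DecidableEq ι] [DecidableEq g.Site] (blk : S → g.Site) (d : ℕ)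
    (δ₀ δ δP δG δ1 ρc αc αv α₃ c₄ α β ρ₁ α'' Λ Λρ₁ κQ BG B₁ Bc' κC cF Cq a₀ κP κP' κ₁ α₁ d₀ M₂ : ℝ)
    (kQ kF : g.Site → S → 𝔸 →L[ℝ] 𝔸) (sQ sF : S → 𝔸 →L[ℝ] 𝔸) (cfun w : g.Site → ℝ)
    (hκQ : 0 < κQ) (hBG : 0 < BG) (hB₁ : 0 < B₁) (hcF : 0 < cF) (hCq : 0 ≤ Cq) (ha₀ : 0 ≤ a₀) (hκP' : 0 ≤ κP') (hα₁ : 0 ≤ α₁) (hΛ : 1 ≤ Λ)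
    (hα : 0 ≤ α) (hβ : 0 ≤ β) (hδ₀ : 0 < δ₀) (hδ : 0 ≤ δ) (hM₂ : 0 ≤ M₂)
    (hrP : δ + 2 * ((α + β) * δ₀) ≤ δP) (hrG : δP + (2 * α + β) * δ₀ ≤ δG)
    (hr1 : ρ₁ + (α + β) * δ₀ ≤ δG) (hα''1 : α'' ≤ 1) (hα''0 : 0 ≤ α'') (hρ₁ : 0 ≤ ρ₁) (hα''ρ : 0 ≤ (1 - α'') * ρ₁)
    (hα''ρ2 : 0 ≤ (1 - 2 * α'') * ρ₁) (hα''ρ3 : 0 ≤ (1 - 3 * α'') * ρ₁) (hΛρ₁ : 0 ≤ Λρ₁)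
    (hr368 : δP + 2 * ((2 * α + β) * δ₀) ≤ B9Ineq368Vprime.rateC α'' ρ₁)
    -- the (Q′G′²Q′*)⁻¹-clause chain has its own rates (FILE 19)
    (hrc1 : ρc + (α + β) * δ₀ ≤ δ1) (hρc : 0 ≤ ρc) (hαc0 : 0 ≤ αc) (hαc1 : αc ≤ 1)
    (hrc : δ₀ / 2 + (α + β) * δ₀ ≤ (1 - αc) * ρc) (hrcG : δG + (α + β) * δ₀ ≤ (1 - αc) * ρc) (hGδ1 : δG ≤ δ1) (hGδ₀ : δG ≤ δ₀)
    (hαv0 : 0 < αv) (hαv : αv < 1 / 2) (hα₃ : α₃ < 1) (hc₄ : 0 < c₄) (hrCinv : δG ≤ (1 - α₃) * ((1 / 2 - αv) * δ₀))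
    (hc₁v : 0 < B6.c1 d δ₀ (1 / 2 + αv)) (hc₁v' : 0 < B6.c1 d ((1 / 2 - αv) * δ₀) α₃) (hc₂ : 0 < B6.c1 d δ₀ β)
    (hcc' : 0 < B6.c1 d ρc αc)
    (hκC : κC = kappa366 κQ cF
      (kappa385 1 (cVConc (Fintype.card κ) 1 α₁ a₀ Cq M₂ (∑ i, ‖b i‖) (Real.exp (δ1 * d₀))) 0 0 Λ (B6.c1 d δ₀ β)) BG
      (BG * B6.c1 d ρc αc *
        (1 - theta363 (Fintype.card κ) 1 α₁ a₀ Cq M₂ (∑ i, ‖b i‖) (Real.exp (δ1 * d₀)) BG Λ (B6.c1 d δ₀ β) * B6.c1 d ρc αc)⁻¹)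
      Λ (B6.c1 d δ₀ β) α₁)
    (hBc' : Bc' = 2 * B₁ * B6.c1 d ((1 / 2 - αv) * δ₀) α₃)
    (ha₁ : α₁ ≤ (2 * (κC * B₁ * c₄ * B6.c1 d δ₀ (1 / 2 + αv)) * B6.c1 d ((1 / 2 - αv) * δ₀) α₃)⁻¹)
    (hκP : κP = kappa349 κQ ((1 + Fintype.card κ) * BG) B₁ Λ (B6.c1 d δ₀ β))
    (hκ₁ : κ₁ = kappa377 (4 * (1 + Fintype.card κ) * (M₂ * ∑ i, ‖b i‖) * Real.exp (δP * d₀)) κP κP' Λ (B6.c1 d δ₀ β) α₁)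
    (hdnn : ∀ a a' : g.Site, 0 ≤ g.dist a a') (htri : Triangle254 (toB6 g Rr H)) (hrefl : ∀ y : g.Site, g.dist y y = 0)
    (hsym : ∀ y y' : g.Site, g.dist y y' = g.dist y' y) (hlen : ∀ y : g.Site, 0 < g.len y)
    (h261 : Ineq261 d (toB6 g Rr H) δ₀ β) (h261'' : Ineq261 d (toB6 g Rr H) ρ₁ α'')
    (h261c : Ineq261 d (toB6 g Rr H) ρc αc) (h261v : Ineq261 d (toB6 g Rr H) δ₀ (1 / 2 + αv))
    (h261v' : Ineq261 d (toB6 g Rr H) ((1 / 2 - αv) * δ₀) α₃)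
    (hT1 : ScaleTransfer g δ₀ α Λ (fun a => g.len a)) (hT2 : ScaleTransfer g δ₀ α Λ (fun a => g.len a ^ 2))
    (hT1i : ScaleTransfer g δ₀ α Λ (fun a => (g.len a)⁻¹)) (hT2i : ScaleTransfer g δ₀ α Λ (fun a => (g.len a ^ 2)⁻¹))
    (hT4 : ScaleTransfer g δ₀ α Λ (fun a => (g.len a ^ 4)⁻¹))
    (hTρ₁ : ScaleTransfer g ρ₁ α'' Λρ₁ (fun a => g.len a)) (hT4v : ScaleTransfer g δ₀ αv c₄ (fun y => g.len y ^ (-(4 : ℝ))))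
    (hrepr : ∀ (v : 𝔸) (i : ι), |b.repr v i| ≤ M₂ * ‖v‖) (hη : 0 < g.eta) (A : κ → S → 𝔸)
    (hsmall : ∀ y : g.Site, g.eta * (α₁ * (g.len y)⁻¹) ≤ 1 / 4)
    (hU1 : ∀ m z, ‖((U m z : 𝔸ˣ) : 𝔸)‖ ≤ 1 ∧ ‖(((U m z)⁻¹ : 𝔸ˣ) : 𝔸)‖ ≤ 1)
    -- (3.37) for the exponent field, blockwise
    (h337B : ∀ ν k x, ‖((g.eta : ℂ)⁻¹) • covDstar T U ν (A k) x‖ ≤ α₁ * (g.len (blk x) ^ 2)⁻¹)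
    (h337F : ∀ μ ν x, ‖((g.eta : ℂ)⁻¹) • covD T U μ (A ν) x‖ ≤ α₁ * (g.len (blk x) ^ 2)⁻¹)
    (h337Bτ : ∀ μ x, ‖((g.eta : ℂ)⁻¹) • covDstar T U μ (tauB T U μ (A μ)) x‖ ≤ α₁ * (g.len (blk x) ^ 2)⁻¹)
    (hA : ∀ k x, ‖A k x‖ ≤ α₁ * (g.len (blk x))⁻¹) (hAτB : ∀ ν k x, ‖tauB T U ν (A k) x‖ ≤ α₁ * (g.len (blk x))⁻¹)
    -- stencil geometry
    (hd₀B : ∀ μ x, g.dist (blk x) (blk ((T μ).symm x)) ≤ d₀) (hd₀F : ∀ μ x, g.dist (blk x) (blk (T μ x)) ≤ d₀)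
    (hd₀0 : ∀ y : g.Site, g.dist y y ≤ d₀)
    -- Theorem 3.1 (3.42)₁,₂,₃ for `G′(U)` at the rate `δ1`
    {Gp : Module.End ℝ (S × ι → ℝ)}
    (h342_1 : HasMajorant (g := toB6 g Rr H) (fun p : S × ι => blk p.1) Gp
      (fun a a' => BG * g.len a ^ 2 * Real.exp (-(δ1 * g.dist a a'))))
    (h342_2 : ∀ k : κ ⊕ κ, HasMajorant (g := toB6 g Rr H) (fun p : S × ι => blk p.1)
      (conj b (diffLetter T U ((g.eta : ℂ)⁻¹) k) * Gp) (fun a a' => BG * g.len a * Real.exp (-(δ1 * g.dist a a'))))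
    (h342_3 : ∀ k : κ ⊕ κ, HasMajorant (g := toB6 g Rr H) (fun p : S × ι => blk p.1)
      (Gp * conj b (diffLetter T U ((g.eta : ℂ)⁻¹) k)) (fun a a' => BG * g.len a * Real.exp (-(δ1 * g.dist a a'))))
    -- the coarse-lattice letters on the block carrier `P` and Theorem 3.2 for `U` on `P` (FILE 19 twin `B9Thm34GConcreteCBlk`'s block)
    (blkP : P → g.Site) (rep : P → S × ι) (hrep : ∀ p : P, blk (rep p).1 = blkP p) (hinj : Function.Injective rep)
    {Qc Qc' Fc : (S × ι → ℝ) →ₗ[ℝ] (P → ℝ)} {Qcs Qcs' Fcs : (P → ℝ) →ₗ[ℝ] (S × ι → ℝ)}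
    {Linv : Module.End ℝ (P → ℝ)}
    (h357 : Qc' = Qc + Fc) (h357s : Qcs' = Qcs + Fcs)
    (hQc : HasMajorantHom (g := toB6 g Rr H) (fun p : S × ι => blk p.1) blkP Qc
      (fun a a' : g.Site => κQ * (if a = a' then (1 : ℝ) else 0)))
    (hQcs : HasMajorantHom (g := toB6 g Rr H) blkP (fun p : S × ι => blk p.1) Qcs
      (fun a a' : g.Site => κQ * (if a = a' then (1 : ℝ) else 0)))
    (hFc : HasMajorantHom (g := toB6 g Rr H) (fun p : S × ι => blk p.1) blkP Fc
      (fun a a' : g.Site => cF * α₁ * (if a = a' then (1 : ℝ) else 0)))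
    (hFcs : HasMajorantHom (g := toB6 g Rr H) blkP (fun p : S × ι => blk p.1) Fcs
      (fun a a' : g.Site => cF * α₁ * (if a = a' then (1 : ℝ) else 0)))
    (hLinv : (Qc ∘ₗ (Gp * Gp) ∘ₗ Qcs) * Linv = 1)
    (h348 : HasMajorant (g := toB6 g Rr H) blkP Linv
      (fun a a' => B₁ * g.len a ^ (-(4 : ℝ)) * Real.exp (-(δ₀ * g.dist a a'))))
    (hθc : theta363 (Fintype.card κ) 1 α₁ a₀ Cq M₂ (∑ i, ‖b i‖) (Real.exp (δ1 * d₀)) BG Λ (B6.c1 d δ₀ β) *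
      B6.c1 d ρc αc < 1)
    -- the data of the CONCRETE `V′(A)` of (3.60) and the smallness/constant conditions of `B9Ineq363Vprime`/`B9Ineq368Vprime`
    (hw : ∀ y, 0 ≤ w y) (hcard : ∀ y, ((B9Eq360Vprime.block blk y).card : ℝ) * w y ≤ 1)
    (hkQ : ∀ y x, blk x = y → ‖kQ y x‖ ≤ w y) (hkF : ∀ y x, blk x = y → ‖kF y x‖ ≤ Cq * α₁ * w y)
    (hsQ : ∀ x, ‖sQ x‖ ≤ 1) (hsF : ∀ x, ‖sF x‖ ≤ Cq * α₁) (hcfun : ∀ y, |cfun y| ≤ a₀ * (g.len y ^ 2)⁻¹)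
    (hθ : theta363 (Fintype.card κ) 1 α₁ a₀ Cq M₂ (∑ i, ‖b i‖) (Real.exp (δG * d₀)) BG Λ (B6.c1 d δ₀ β) *
      B6.c1 d ρ₁ α'' < 1)
    (hθL : thetaL363 (Fintype.card κ) 1 α₁ a₀ Cq M₂ (∑ i, ‖b i‖) (Real.exp (δG * d₀)) BG Λ (B6.c1 d δ₀ β) *
      B6.c1 d ρ₁ α'' < 1)
    -- the constant `κ_{P′}` of the (3.77)-step dominates the four explicit (3.68)-constants of `B9Ineq368Vprime`
    (hK1 : kappa368 κQ cF
        (kappa385 1 (cVConc (Fintype.card κ) 1 α₁ a₀ Cq M₂ (∑ i, ‖b i‖) (Real.exp (δG * d₀))) 0 0 Λ (B6.c1 d δ₀ β))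
        κC BG BG (BG * B6.c1 d ρ₁ α'' *
          (1 - theta363 (Fintype.card κ) 1 α₁ a₀ Cq M₂ (∑ i, ‖b i‖) (Real.exp (δG * d₀)) BG Λ (B6.c1 d δ₀ β) * B6.c1 d ρ₁ α'')⁻¹)
        B₁ Bc' Λ (B6.c1 d δ₀ β) α₁ ≤ κP')
    (hK3 : Fintype.card κ * kappa368Ds κQ cF
        (kappa385 BG (cVConc (Fintype.card κ) 1 α₁ a₀ Cq M₂ (∑ i, ‖b i‖) (Real.exp (δG * d₀))) 0 0 Λ (B6.c1 d δ₀ β))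
        κC BG BG BG (B6.c1 d ρ₁ α'' *
          (1 - theta363 (Fintype.card κ) 1 α₁ a₀ Cq M₂ (∑ i, ‖b i‖) (Real.exp (δG * d₀)) BG Λ (B6.c1 d δ₀ β) * B6.c1 d ρ₁ α'')⁻¹)
        (BG * Λρ₁ ^ 2 * B6.c1 d ρ₁ α'' *
          (1 - thetaL363 (Fintype.card κ) 1 α₁ a₀ Cq M₂ (∑ i, ‖b i‖) (Real.exp (δG * d₀)) BG Λ (B6.c1 d δ₀ β) * B6.c1 d ρ₁ α'')⁻¹)
        B₁ Bc' (cBConc (Fintype.card κ) M₂ (∑ i, ‖b i‖) (Real.exp (B9Ineq368Vprime.rateC α'' ρ₁ * d₀)))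
        (cCConc (Fintype.card κ) 1 α₁ a₀ Cq M₂ (∑ i, ‖b i‖) (Real.exp (B9Ineq368Vprime.rateC α'' ρ₁ * d₀))) Λ (B6.c1 d δ₀ β) α₁
        ≤ κP') :
    ∃ Tinv : Module.End ℝ (P → ℝ),
      Tinv * (Qc' ∘ₗ ((gPrimeExtEnd Gp (conj b (vPrimeConc T U g.eta A blk kQ kF sQ sF cfun) * Gp)) * (gPrimeExtEnd Gp (conj b (vPrimeConc T U g.eta A blk kQ kF sQ sF cfun) * Gp))) ∘ₗ Qcs') = 1 ∧
      (Qc' ∘ₗ ((gPrimeExtEnd Gp (conj b (vPrimeConc T U g.eta A blk kQ kF sQ sF cfun) * Gp)) * (gPrimeExtEnd Gp (conj b (vPrimeConc T U g.eta A blk kQ kF sQ sF cfun) * Gp))) ∘ₗ Qcs') * Tinv = 1 ∧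
      HasMajorant (g := toB6 g Rr H) (fun q : (κ × S) × ι => blk q.1.2)
        (((conjHom b (gradLin T ((g.eta : ℂ)⁻¹) (prodCfg U g.eta A)) - conjHom b (gradLin T ((g.eta : ℂ)⁻¹) U)) ∘ₗ (Gp ∘ₗ Qcs ∘ₗ Linv ∘ₗ Qc ∘ₗ Gp) ∘ₗ conjHom b (divLin T ((g.eta : ℂ)⁻¹) U)
              + conjHom b (gradLin T ((g.eta : ℂ)⁻¹) U) ∘ₗ (Gp ∘ₗ Qcs ∘ₗ Linv ∘ₗ Qc ∘ₗ Gp) ∘ₗ (conjHom b (divLin T ((g.eta : ℂ)⁻¹) (prodCfg U g.eta A)) - conjHom b (divLin T ((g.eta : ℂ)⁻¹) U))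
              + (conjHom b (gradLin T ((g.eta : ℂ)⁻¹) (prodCfg U g.eta A)) - conjHom b (gradLin T ((g.eta : ℂ)⁻¹) U)) ∘ₗ (Gp ∘ₗ Qcs ∘ₗ Linv ∘ₗ Qc ∘ₗ Gp) ∘ₗ (conjHom b (divLin T ((g.eta : ℂ)⁻¹) (prodCfg U g.eta A)) - conjHom b (divLin T ((g.eta : ℂ)⁻¹) U))
              + conjHom b (gradLin T ((g.eta : ℂ)⁻¹) (prodCfg U g.eta A)) ∘ₗ (B9Eq360Vprime.pPrime Gp (gPrimeExtEnd Gp (conj b (vPrimeConc T U g.eta A blk kQ kF sQ sF cfun) * Gp)) (Qcs ∘ₗ secRes rep) (Qcs' ∘ₗ secRes rep) (secConj rep Linv) (secConj rep Tinv) (secExt rep ∘ₗ Qc) (secExt rep ∘ₗ Qc')) ∘ₗ conjHom b (divLin T ((g.eta : ℂ)⁻¹) (prodCfg U g.eta A))))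
        (fun a a' => κ₁ * α₁ * (g.len a ^ 2)⁻¹ * Real.exp (-(δ * g.dist a a'))) := by
  -- signs, rates, the block-diagonal majorants in FILE 18's `if … then κ else 0` form
  have hSb : 0 ≤ ∑ i, ‖b i‖ := Finset.sum_nonneg fun i _ => norm_nonneg _
  have hΛ0 : 0 < Λ := zero_lt_one.trans_le hΛ
  have hαβ : 0 ≤ (α + β) * δ₀ := mul_nonneg (add_nonneg hα hβ) hδ₀.le
  have h2αβ : 0 ≤ (2 * α + β) * δ₀ := mul_nonneg (add_nonneg (mul_nonneg zero_le_two hα) hβ) hδ₀.le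
  have hδP0 : 0 ≤ δP := le_trans (add_nonneg hδ (mul_nonneg zero_le_two hαβ)) hrP
  have hδG0 : 0 ≤ δG := le_trans (le_trans hδP0 (le_add_of_nonneg_right h2αβ)) hrG
  have hδ1_0 : 0 ≤ δ1 := le_trans (add_nonneg hρc hαβ) hrc1
  have hαcρ : 0 ≤ (1 - αc) * ρc := mul_nonneg (sub_nonneg.mpr hαc1) hρc
  have hcV0 : 0 ≤ kappa385 1 (cVConc (Fintype.card κ) 1 α₁ a₀ Cq M₂ (∑ i, ‖b i‖) (Real.exp (δ1 * d₀))) 0 0 Λ (B6.c1 d δ₀ β) :=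
    kappa385_nonneg zero_le_one (cVConc_nonneg hα₁ ha₀ hCq hM₂ hSb (Real.exp_nonneg _)) le_rfl le_rfl hΛ0.le
      (B6RandomWalk.c1_nonneg d δ₀ β)
  have hθc0 : 0 ≤ theta363 (Fintype.card κ) 1 α₁ a₀ Cq M₂ (∑ i, ‖b i‖) (Real.exp (δ1 * d₀)) BG Λ (B6.c1 d δ₀ β) :=
    theta363_nonneg hα₁ ha₀ hCq hM₂ hSb (Real.exp_nonneg _) hBG.le hΛ0.le (B6RandomWalk.c1_nonneg d δ₀ β)
  have hB₁' : 0 < BG * B6.c1 d ρc αc *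
      (1 - theta363 (Fintype.card κ) 1 α₁ a₀ Cq M₂ (∑ i, ‖b i‖) (Real.exp (δ1 * d₀)) BG Λ (B6.c1 d δ₀ β) * B6.c1 d ρc αc)⁻¹ :=
    mul_pos (mul_pos hBG hcc') (inv_pos.mpr (by linarith))
  have hκC0 : 0 ≤ κC := by
    rw [hκC]; exact (kappa366_pos hκQ hcF hcV0 hB₁' hΛ0 hc₂ hα₁).le
  have hBc0 : 0 ≤ Bc' := by
    rw [hBc']; exact mul_nonneg (mul_nonneg zero_le_two hB₁.le) hc₁v'.le
  have hind : ∀ κ₀ : ℝ, (fun a a' : g.Site => κ₀ * (if a = a' then (1 : ℝ) else 0)) = fun a a' : g.Site => if a = a' then κ₀ else 0 :=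
    fun κ₀ => by
      funext a a'
      split_ifs <;> simp
  have hQc' := hQc
  have hQcs' := hQcs
  have hFc' := hFc
  have hFcs' := hFcs
  rw [hind] at hQc' hQcs' hFc' hFcs'
  have hw1 : ∀ a : g.Site, 0 ≤ g.len a := fun a => (hlen a).le
  have h342_1G : HasMajorant (g := toB6 g Rr H) (fun p : S × ι => blk p.1) Gp
      (fun a a' => BG * g.len a ^ 2 * Real.exp (-(δG * g.dist a a'))) :=
    hasMajorant_rate_mono (R := Rr) (H := H) _ BG (fun a => g.len a ^ 2) hBG.le (fun a => sq_nonneg _) hGδ1 hdnn h342_1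
  have h342_2G : ∀ k : κ ⊕ κ, HasMajorant (g := toB6 g Rr H) (fun p : S × ι => blk p.1)
      (conj b (diffLetter T U ((g.eta : ℂ)⁻¹) k) * Gp) (fun a a' => BG * g.len a * Real.exp (-(δG * g.dist a a'))) := fun k =>
    hasMajorant_rate_mono (R := Rr) (H := H) _ BG (fun a => g.len a) hBG.le hw1 hGδ1 hdnn (h342_2 k)
  have h342_3G : ∀ k : κ ⊕ κ, HasMajorant (g := toB6 g Rr H) (fun p : S × ι => blk p.1)
      (Gp * conj b (diffLetter T U ((g.eta : ℂ)⁻¹) k)) (fun a a' => BG * g.len a * Real.exp (-(δG * g.dist a a'))) := fun k =>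
    hasMajorant_rate_mono (R := Rr) (H := H) _ BG (fun a => g.len a) hBG.le hw1 hGδ1 hdnn (h342_3 k)
  -- the shapes `B9Ineq366Vprime`/`B9Ineq363Vprime` read (3.37)/stencil geometry in
  have hA' : ∀ μ x, ‖A μ x‖ ≤ α₁ * (g.len (blk x))⁻¹ ∧ ‖tauB T U μ (A μ) x‖ ≤ α₁ * (g.len (blk x))⁻¹ :=
    fun μ x => ⟨hA μ x, hAτB μ μ x⟩
  have h337s' : ∀ μ x, ‖((g.eta : ℂ)⁻¹) • covDstar T U μ (A μ) x‖ ≤ α₁ * (g.len (blk x) ^ 2)⁻¹ := fun μ x => h337B μ μ x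
  have hd₀' : ∀ μ x, g.dist (blk x) (blk (T μ x)) ≤ d₀ ∧ g.dist (blk x) (blk ((T μ).symm x)) ≤ d₀ :=
    fun μ x => ⟨hd₀F μ x, hd₀B μ x⟩
  set V := (conj b (vPrimeConc T U g.eta A blk kQ kF sQ sF cfun)) with hVdef
  set E := gPrimeExtEnd Gp (V * Gp) with hEdef
  -- «The inverse satisfies Theorem 3.2»: `C⁻¹(U′U)` for the concrete `V′(A)` and `G′(U′U)` (gen 9), threshold `ha₁`
  have ha₁' := ha₁
  rw [hκC] at ha₁'
  obtain ⟨Tinv, hTl, hTr, hTker⟩ := inverse_satisfies_thm32_vPrime_blk (Rr := Rr) (H := H) b T U blk blkP d hη A kQ kF sQ sF cfun w 1 d₀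
    M₂ Cq a₀ δ₀ δ1 α β ρc Λ BG α₁ αc κQ cF αv α₃ c₄ B₁ hBG hα₁ hΛ0 hρc hα hβ hδ₀ hδ1_0 hκQ hcF hαv0 hαv hα₃ hc₄ hB₁ hrc1
    hαc0 hαc1 hrc hc₁v hc₁v' hc₂ hcc' hdnn hrefl hsym htri hlen h261 h261c h261v h261v' hT1 hT2 hT4v hM₂ hrepr hsmall hA'
    h337s' hU1 hd₀' hd₀0 hw hcard hCq ha₀ hkQ hkF hsQ hsF hcfun hθc h342_1 h342_2 h357 h357s hQc hQcs hFc hFcs hLinv h348 ha₁'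
  -- (3.66) for the concrete `C′(A)` delivered at the rate `δ_G` (gen 9)
  have h366G : HasMajorant (g := toB6 g Rr H) blkP (cPrimeHom Qc Fc Qcs Fcs Gp E V)
      (fun a a' => κC * α₁ * g.len a ^ 4 * Real.exp (-(δG * g.dist a a'))) := by
    rw [hκC]
    exact hasMajorant_cPrimeHom_vPrime_blk (Rr := Rr) (H := H) b T U blk blkP d hη A kQ kF sQ sF cfun w 1 d₀ M₂ Cq a₀ δ₀ δ1 α β ρc
      δG Λ BG α₁ αc κQ cF hBG.le hα₁ hΛ0.le hρc hδG0 hα hβ hδ₀.le hδ1_0 hκQ.le hcF.le hrc1 hαc0 hαc1 hrcG hdnn hrefl htri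
      hlen h261 h261c hT1 hT2 hM₂ hrepr hsmall hA' h337s' hU1 hd₀' hd₀0 hw hcard hCq ha₀ hkQ hkF hsQ hsF hcfun hθc h342_1
      h342_2 hQc hQcs hFc hFcs
  -- (3.63) ⇒ ‖V′G′‖ < 1 ⇒ both forms of (3.65) for `E` ⇒ the p. 403 expansion `L′ = L + C′(A)` ⇒ (3.67) on 𝔅
  have h363 := ineq363_op_vPrime (Rr := Rr) (H := H) b T U blk d hη A kQ kF sQ sF cfun w 1 d₀ M₂ Cq a₀ δ₀ δ1 α β ρc Λ BG
    α₁ hBG.le hα₁ hΛ0.le hρc hα hβ hδ₀.le hδ1_0 hrc1 hdnn htri hlen h261 hT1 hT2 hM₂ hrepr hsmall hA' h337s' hU1 hd₀' hd₀0 hw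
    hcard hCq ha₀ hkQ hkF hsQ hsF hcfun h342_1 h342_2
  have hW : ‖B9Eq360Vprime.toCLM (V * Gp)‖ < 1 :=
    opNorm_lt_one_of_363_261 (g := toB6 g Rr H) (fun p : S × ι => blk p.1) d ρc αc _ hθc0 hαcρ hdnn h261c hθc h363
  have h365l : E = Gp + Gp * V * E := eq365_end_left Gp V hW
  have h365r : E = Gp + E * V * Gp := by
    have h := eq365_end Gp (V * Gp) hW
    rwa [← mul_assoc] at h
  have h365 := eq365b_hom Qc Qc' Fc Qcs Qcs' Fcs Gp E V h357 h357s h365l h365r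
  have h367 : Tinv - Linv = -(Tinv * cPrimeHom Qc Fc Qcs Fcs Gp E V * Linv) := by
    have e1 : Tinv - Linv = Tinv * ((Qc ∘ₗ (Gp * Gp) ∘ₗ Qcs) * Linv) - Tinv * (Qc' ∘ₗ (E * E) ∘ₗ Qcs') * Linv := by
      rw [hLinv, hTl, mul_one, one_mul]
    rw [e1, h365, mul_add, add_mul, ← mul_assoc]
    abel
  -- the two (3.48) block majorants over `blkP` at the rate `δ_G` (rate weakening only)
  have h348G : HasMajorant (g := toB6 g Rr H) blkP Linv
      (fun a a' => B₁ * g.len a ^ (-(4 : ℝ)) * Real.exp (-(δG * g.dist a a'))) :=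
    hasMajorant_rate_mono (R := Rr) (H := H) blkP B₁ (fun a => g.len a ^ (-(4 : ℝ))) hB₁.le
      (fun a => Real.rpow_nonneg (hlen a).le _) hGδ₀ hdnn h348
  have h348T : HasMajorant (g := toB6 g Rr H) blkP Tinv
      (fun a a' => Bc' * g.len a ^ (-(4 : ℝ)) * Real.exp (-(δG * g.dist a a'))) := by
    rw [hBc']
    exact hasMajorant_rate_mono (R := Rr) (H := H) blkP (2 * B₁ * B6.c1 d ((1 / 2 - αv) * δ₀) α₃) (fun a => g.len a ^ (-(4 : ℝ)))
      (mul_nonneg (mul_nonneg zero_le_two hB₁.le) hc₁v'.le) (fun a => Real.rpow_nonneg (hlen a).le _) hrCinv hdnn hTker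
  -- §1: (3.77) for the concrete `P₁(A)` with `C⁻¹(U′U) = Tinv`, `C′(A)` the concrete (3.66) letter, on the block carrier
  have hP₁ := hasMajorant_pOne_coarse_blk (Rr := Rr) (H := H) b T U blk d δ₀ δ δP δG α β ρ₁ α'' Λ Λρ₁ κQ BG B₁ Bc' κC cF Cq a₀ κP κP' κ₁ α₁ d₀ M₂
    kQ kF sQ sF cfun w hκQ.le hBG.le hB₁.le hBc0 hκC0 hcF.le hCq ha₀ hκP' hα₁ hΛ hα hβ hδ₀.le hδ hM₂ hrP hrG hr1 hα''1 hα''0 hρ₁ hα''ρ hα''ρ2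
    hα''ρ3 hΛρ₁ hr368 hκP hκ₁ hdnn htri hrefl hsym hlen h261 h261'' hT1 hT2 hT1i hT2i hT4 hTρ₁ hrepr hη A hsmall hU1 h337B h337F h337Bτ hA hAτB
    hd₀B hd₀F hd₀0 h342_1G h342_2G h342_3G blkP rep hrep hinj h357 h357s h367 hQc' hQcs' hFc' hFcs' h348G h348T h366G hw hcard hkQ hkF hsQ hsF hcfun hθ
    hθL hK1 hK3
  exact ⟨Tinv, hTl, hTr, hP₁⟩

end CInv

end Literature.MathematicalPhysics.QuantumFieldTheory.Balaban1983to89.B9Thm34GKernelFinalBlk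

end
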